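import Mathlib
import Literature.Computability.AlgebraicComplexity.CircuitCoeffIdeal
import Literature.Computability.AlgebraicComplexity.StandardFamilies
import Literature.RingTheory.Localization.MinimalPrimesLocalization
import HarnessLib

/-!
# LangWeilTransfer — crux `ShatteringExclusion` (stmt-ValiantsHypothesis-6372), line `birth`:
# the unibranch clause of `stub_unibranching` is local irreducibility of the constants variety

Route `ValiantsHypothesis/LangWeilTransfer`, crux `ShatteringExclusion`, registered line
`Cruxes/ShatteringExclusion/Lines/birth.lean`, stub `stub_unibranching` (the line's structural
bet, conjecture grade): a near-optimal circuit `P` for `per_n` with constants in a number field of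
polynomial degree can be rewired so that its constant vector `y = slotConst P` lies on EXACTLY ONE
irreducible component of the complexified constants (coefficient) variety `V_ℂ(I)` — typed as:
a unique minimal prime of `I·ℂ[Y]` below the point ideal `ker (ev_y)`, where `I ⊆ ℚ[Y_0..Y_{4s}]`
is the circuit coefficient ideal of the integer skeleton of `P` against `per_n`
(`Literature.Computability.AlgebraicComplexity.circuitCoeffIdeal`, definitionally the ideal
written out in the stub).

This file turns that clause into LOCAL ALGEBRA at the point, the shape in which any certificate
(smooth point, Jacobian of generic rank, normal/unibranch local ring) would actually be proved:

* `existsUnique_minimalPrimes_le_ker_iff` — for ANY circuit `P` over `ℂ` and ANY integer target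
  `g`, with `y = slotConst P` and `𝔪_y = ker (ev_y)`:
  (∃! minimal prime of `I·ℂ[Y]` below `𝔪_y`) ↔ (the radical of `I·ℂ[Y]_{𝔪_y}` is prime), i.e.
  `V_ℂ(I)` is irreducible in the local ring at `y` (tree:
  `Literature.RingTheory.Localization.existsUnique_minimalPrimes_le_iff_isPrime_radical_map`,
  Atiyah–Macdonald Cor. 3.13).
* `existsUnique_minimalPrimes_le_ker_of_isDomain` — sufficient: `ℂ[Y]_{𝔪_y} ⧸ I` a domain (e.g.
  `y` a smooth point of `V_ℂ(I)`: regular local rings are domains).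
* `existsUnique_minimalPrimes_le_ker_of_isPrime_radical` — sufficient: `V_ℂ(I)` irreducible
  (`√(I·ℂ[Y])` prime), provided `P` computes `g` (so that `y ∈ V_ℂ(I)`,
  `aeval_slotConst_eq_zero_of_computes`).
* `unibranching_of_locallyIrreducibleRewiring` — hence `stub_unibranching` (conclusion verbatim)
  follows from the same rewiring statement with the `∃!` clause replaced by primality of the local
  radical.

Honest framing: no rewiring is constructed here — whether every near-optimal circuit for `per_n`
CAN be rewired to a locally irreducible point of its constants variety is exactly the open bet of
the line (a "Galois-dark" world, where every low-degree point of every near-optimal constants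
variety is a crossing of conjugate components, is not excluded by any known technique). The stub,
the crux and the route stay open; VP ≠ VNP is not moved.
-/

noncomputable section

open MvPolynomial

-- the summit and the problem share the name `ValiantsHypothesis` (D-0017 single-conjunct layout)
set_option linter.dupNamespace false

namespace Summit.ValiantsHypothesis.ValiantsHypothesis.Theorems.LangWeilTransfer.ShatteringExclusion

open Literature.Computability.AlgebraicComplexity
open Literature.Computability.AlgebraicComplexity.ArithCircuit

-- The point ideal `𝔪_y = ker (ev_y) ⊂ ℂ[Y]` is prime (`ℂ` is a domain: Mathlib
-- `RingHom.ker_isPrime`); the statements below take this instance as the binder `[hq]`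
-- (supply `(hq := RingHom.ker_isPrime _)`), so that `Localization.AtPrime 𝔪_y` elaborates.

/-- **The unibranch clause is local irreducibility.** For a circuit `P` over `ℂ` with `s` gates,
an integer target `g`, the complexified circuit coefficient ideal `I_ℂ = I·ℂ[Y_0..Y_{4s}]` and the
constant vector `y = slotConst P`: exactly one minimal prime of `I_ℂ` lies below
`𝔪_y = ker (ev_y)` iff the radical of `I_ℂ · ℂ[Y]_{𝔪_y}` is prime (the constants variety is
irreducible in the local ring at `y`). [cite: AtiyahMacdonald1969, Cor. 3.13] -/
theorem existsUnique_minimalPrimes_le_ker_iff {σ : Type*} (P : ArithCircuit ℂ σ)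
    (g : MvPolynomial σ ℤ)
    [hq : (RingHom.ker (MvPolynomial.aeval (R := ℂ)
            (fun v : Fin (4 * P.size + 1) => slotConst P v))).IsPrime] :
    (∃! 𝔓 : Ideal (MvPolynomial (Fin (4 * P.size + 1)) ℂ),
        𝔓 ∈ ((circuitCoeffIdeal P g).map (MvPolynomial.map (algebraMap ℚ ℂ))).minimalPrimes ∧
          𝔓 ≤ RingHom.ker (MvPolynomial.aeval (R := ℂ)
            (fun v : Fin (4 * P.size + 1) => slotConst P v))) ↔
      (((circuitCoeffIdeal P g).map (MvPolynomial.map (algebraMap ℚ ℂ))).map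
          (algebraMap (MvPolynomial (Fin (4 * P.size + 1)) ℂ)
          (Localization.AtPrime (RingHom.ker (MvPolynomial.aeval (R := ℂ)
            (fun v : Fin (4 * P.size + 1) => slotConst P v)))))).radical.IsPrime :=
  Literature.RingTheory.Localization.existsUnique_minimalPrimes_le_iff_isPrime_radical_map _ _

/-- Sufficient condition (smooth-point shape): if `ℂ[Y]_{𝔪_y} ⧸ I_ℂ ℂ[Y]_{𝔪_y}` is a domain —
e.g. a regular local ring, the case of a point `y` at which the constants variety is smooth —
then `y` lies on exactly one irreducible component. [cite: AtiyahMacdonald1969, Cor. 3.13] -/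
theorem existsUnique_minimalPrimes_le_ker_of_isDomain {σ : Type*} (P : ArithCircuit ℂ σ)
    (g : MvPolynomial σ ℤ)
    [hq : (RingHom.ker (MvPolynomial.aeval (R := ℂ)
            (fun v : Fin (4 * P.size + 1) => slotConst P v))).IsPrime]
    (hdom : IsDomain ((Localization.AtPrime (RingHom.ker (MvPolynomial.aeval (R := ℂ)
            (fun v : Fin (4 * P.size + 1) => slotConst P v)))) ⧸
      (((circuitCoeffIdeal P g).map (MvPolynomial.map (algebraMap ℚ ℂ))).map
        (algebraMap (MvPolynomial (Fin (4 * P.size + 1)) ℂ)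
          (Localization.AtPrime (RingHom.ker (MvPolynomial.aeval (R := ℂ)
            (fun v : Fin (4 * P.size + 1) => slotConst P v)))))))) :
    ∃! 𝔓 : Ideal (MvPolynomial (Fin (4 * P.size + 1)) ℂ),
        𝔓 ∈ ((circuitCoeffIdeal P g).map (MvPolynomial.map (algebraMap ℚ ℂ))).minimalPrimes ∧
          𝔓 ≤ RingHom.ker (MvPolynomial.aeval (R := ℂ)
            (fun v : Fin (4 * P.size + 1) => slotConst P v)) :=
  Literature.RingTheory.Localization.existsUnique_minimalPrimes_le_of_isDomain_quotient_map _ _ hdom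

/-- The constant vector of a fan-in-two circuit computing the image of `g` is a zero of the
complexified coefficient ideal: `I_ℂ ≤ 𝔪_y`. [cite: Burgisser2000TCS, §5 (A3) p. 85] -/
theorem map_circuitCoeffIdeal_le_ker {σ : Type*} (P : ArithCircuit ℂ σ) (h2 : P.IsFanInTwo)
    (g : MvPolynomial σ ℤ) (hP : P.Computes (map (Int.castRingHom ℂ) g)) :
    ((circuitCoeffIdeal P g).map (MvPolynomial.map (algebraMap ℚ ℂ))) ≤
      RingHom.ker (MvPolynomial.aeval (R := ℂ)
            (fun v : Fin (4 * P.size + 1) => slotConst P v)) := by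
  rw [Ideal.map_le_iff_le_comap]
  intro f hf
  rw [Ideal.mem_comap, RingHom.mem_ker, aeval_map_algebraMap]
  exact aeval_slotConst_eq_zero_of_computes P h2 hP hf

/-- Sufficient condition (irreducible-fibre shape): if the whole complexified constants variety
is irreducible (`√I_ℂ` prime) and `P` computes the image of `g`, then its constant vector lies on
exactly one component. [cite: AtiyahMacdonald1969, Prop. 1.14] -/
theorem existsUnique_minimalPrimes_le_ker_of_isPrime_radical {σ : Type*} (P : ArithCircuit ℂ σ)
    (h2 : P.IsFanInTwo) (g : MvPolynomial σ ℤ) (hP : P.Computes (map (Int.castRingHom ℂ) g))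
    [hq : (RingHom.ker (MvPolynomial.aeval (R := ℂ)
            (fun v : Fin (4 * P.size + 1) => slotConst P v))).IsPrime]
    (hirr : ((circuitCoeffIdeal P g).map (MvPolynomial.map (algebraMap ℚ ℂ))).radical.IsPrime) :
    ∃! 𝔓 : Ideal (MvPolynomial (Fin (4 * P.size + 1)) ℂ),
        𝔓 ∈ ((circuitCoeffIdeal P g).map (MvPolynomial.map (algebraMap ℚ ℂ))).minimalPrimes ∧
          𝔓 ≤ RingHom.ker (MvPolynomial.aeval (R := ℂ)
            (fun v : Fin (4 * P.size + 1) => slotConst P v)) :=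
  Literature.RingTheory.Localization.existsUnique_minimalPrimes_le_of_isPrime_radical hirr
    (map_circuitCoeffIdeal_le_ker P h2 g hP)

/-- **`stub_unibranching` from a locally irreducible rewiring.** If near-optimal circuits for
`per_n` with constants of polynomial degree can be rewired (polynomial cost, polynomial degree) so
that the constants variety of the new circuit is irreducible IN THE LOCAL RING at the new constant
vector (primality of the local radical — e.g. a smooth point), then the registered stub
`stub_unibranching` holds (conclusion verbatim: the coefficient ideal is written out as in the
route file; it is `circuitCoeffIdeal P (perPoly (Fin n) ℤ)` by definition). [folklore] -/
theorem unibranching_of_locallyIrreducibleRewiring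
    (h : ∀ c d₀ : ℕ, ∃ c' d₀' N : ℕ, ∀ n ≥ N,
      (∃ P : ArithCircuit ℂ (Fin n × Fin n),
          P.IsFanInTwo ∧ P.size ≤ n ^ c ∧ P.Computes (perPoly (Fin n) ℂ) ∧
            ∃ K : IntermediateField ℚ ℂ, FiniteDimensional ℚ K ∧ Module.finrank ℚ K ≤ n ^ d₀ ∧
              ∀ v : Fin (4 * P.size + 1), slotConst P v ∈ K) →
        ∃ P : ArithCircuit ℂ (Fin n × Fin n),
          P.IsFanInTwo ∧ P.size ≤ n ^ c' ∧ P.Computes (perPoly (Fin n) ℂ) ∧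
            ∃ K : IntermediateField ℚ ℂ, FiniteDimensional ℚ K ∧ Module.finrank ℚ K ≤ n ^ d₀' ∧
              (∀ v : Fin (4 * P.size + 1), slotConst P v ∈ K) ∧
              ∀ hq : (RingHom.ker (MvPolynomial.aeval (R := ℂ)
            (fun v : Fin (4 * P.size + 1) => slotConst P v))).IsPrime,
                (((circuitCoeffIdeal P (perPoly (Fin n) ℤ)).map (MvPolynomial.map (algebraMap ℚ ℂ))).map
          (algebraMap (MvPolynomial (Fin (4 * P.size + 1)) ℂ)
          (@Localization.AtPrime _ _ (RingHom.ker (MvPolynomial.aeval (R := ℂ)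
            (fun v : Fin (4 * P.size + 1) => slotConst P v))) hq))).radical.IsPrime) :
    ∀ c d₀ : ℕ, ∃ c' d₀' N : ℕ, ∀ n ≥ N,
      (∃ P : ArithCircuit ℂ (Fin n × Fin n),
          P.IsFanInTwo ∧ P.size ≤ n ^ c ∧ P.Computes (perPoly (Fin n) ℂ) ∧
            ∃ K : IntermediateField ℚ ℂ, FiniteDimensional ℚ K ∧ Module.finrank ℚ K ≤ n ^ d₀ ∧
              ∀ v : Fin (4 * P.size + 1), slotConst P v ∈ K) →
        ∃ P : ArithCircuit ℂ (Fin n × Fin n),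
          P.IsFanInTwo ∧ P.size ≤ n ^ c' ∧ P.Computes (perPoly (Fin n) ℂ) ∧
            ∃ K : IntermediateField ℚ ℂ, FiniteDimensional ℚ K ∧ Module.finrank ℚ K ≤ n ^ d₀' ∧
              (∀ v : Fin (4 * P.size + 1), slotConst P v ∈ K) ∧
              ∃! 𝔓 : Ideal (MvPolynomial (Fin (4 * P.size + 1)) ℂ),
                𝔓 ∈ ((Ideal.span (Set.range fun α : (Fin n × Fin n) →₀ ℕ =>
                  MvPolynomial.map (Int.castRingHom ℚ) (MvPolynomial.coeff α
                    (MvPolynomial.sumAlgEquiv ℤ (Fin n × Fin n) (Fin (4 * P.size + 1))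
                      (skeleton P).eval) -
                    MvPolynomial.C (MvPolynomial.coeff α (perPoly (Fin n) ℤ))))).map
                  (MvPolynomial.map (algebraMap ℚ ℂ))).minimalPrimes ∧
                𝔓 ≤ RingHom.ker (MvPolynomial.aeval (R := ℂ)
                  (fun v : Fin (4 * P.size + 1) => slotConst P v)) := by
  intro c d₀
  obtain ⟨c', d₀', N, hN⟩ := h c d₀
  refine ⟨c', d₀', N, fun n hn hex => ?_⟩
  obtain ⟨P, hP2, hPs, hPc, K, hKfd, hKdeg, hmem, hloc⟩ := hN n hn hex
  refine ⟨P, hP2, hPs, hPc, K, hKfd, hKdeg, hmem, ?_⟩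
  exact (existsUnique_minimalPrimes_le_ker_iff P (perPoly (Fin n) ℤ)
    (hq := RingHom.ker_isPrime _)).2 (hloc (RingHom.ker_isPrime _))

end Summit.ValiantsHypothesis.ValiantsHypothesis.Theorems.LangWeilTransfer.ShatteringExclusion

end
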